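import Summits.QuantumFields.YangMills.Theorems.UnitScaleTiltProp7SymAvgRelativeAnalytic
import Summits.QuantumFields.YangMills.Theorems.UnitScaleTiltProp8ChartDoubleBarOneStep
import Summits.QuantumFields.YangMills.Theorems.UnitScaleTiltProp7SymFrameIterSmall
import Summits.QuantumFields.YangMills.Theorems.UnitScaleTiltProp7SymFrameOneStep
import HarnessLib

/-!
# Route `UnitScaleTilt`, crux K1 child «MinimiserStabilityRegPr» (stmt-QuantumFields-19200), skeleton v10 stub EX, route (α) — brick W4 (OWNER RULING g26-№12
# (T-sym-frames), ACK 25 (2)), PART 1∕2: **THE COVARIANT DOUBLE-BAR TOWER AND THE ACCUMULATED SYMMETRIC FRAMES OF AN ANALYTIC FAMILY ARE ANALYTIC** (generic level)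

For the symmetric, centre-anchored, covariant frames of record (✓`Prop7SymAvgTwSym`: `tstairU`, `vframeCovU`, `dbarCovU`, the tower `dbarCovIterU` against the background
tower, the accumulated frames `frameAccU` — [Balaban1985Averaging] (58), (82), (89), (97), (127)∕(150)), at ANY `P : Params`, over ANY complete normed ℂ-algebra `𝔸`
with `‖1‖ = 1`, for ANY bondwise-analytic family `x ↦ F x` of perturbed fields and a fixed background `U₀`:

* §1 `analyticAt_coe_dbarCovIterU_frameAccU_of_rows` — analyticity of `x ↦ U̿^{(i)}[F x](e)` and `x ↦ v_i[F x](z)` on the read territory, GIVEN level rows «both towers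
  within `ρ` of `1`», `16ℓρ ≤ 1` (`ℓ = (d+2)L`): induction on the level exactly as ✓`Prop7SymAvgRelativeBound.analyticAt_coe_emlIterU_family_of_reads`, carrying the frames —
  the (0.4) `eml` needs its loops within `1` of `1` (`norm_loopHolU_sub_one_lt_one`), the frame `eml` needs the twisted stairs within `1` of `1` (`norm_tstairU_sub_one_lt_one`);
* §2 `analyticAt_coe_dbarCovIterU_frameAccU_of_reads` — the rows DISCHARGED by W2 ✓`Prop7SymFrameIterSmall.diff_frameAccU_le_of_reads` (perturbed tower within
  `2Lᵏ(δ + 30ℓs₀)` of the background tower; its one-step rows `hstep`∕`hframe` displayed verbatim) and ✓`Prop8Chart.norm_emlIterU_sub_one_le_of_reads` (background tower within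
  `30ℓLⁱs₀` of `1`);
* §3 `hstep_of_W1`∕`hframe_of_W1` — W1's one-step suppliers (✓`Prop7SymAvgTwSym.norm_dbarCovU_mul_inv_sub_one_le`, `norm_vframeCovU_sub_one_le_of_diff`) in W2's shape at
  `C₁ := 22100`; `analyticAt_coe_gaugeActT_expUnit_mul` — the gauged perturbed family `A ↦ (e^{A}U₀♭)^{û}` is bondwise entire.

Part 2∕2 (`…Prop7SymFrameBound`): the SU(2) background in the cluster axial gauge and the T³ letters (`frameTwS` analytic on the frame-chart ball, `hr` of the sym-frame bridge,
Cauchy `‖r y‖ ≤ 8∕R`).  Cell `ym3-torus`, seat ym-ust-20520-w3 (gen 4); def-free; YM₃ on T³ is rung R3, not the Clay problem; count-neutral toward stmt-QuantumFields-19200.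

References: T. Bałaban, CMP **98** (1985) 17–51 [Balaban1985Averaging] ((8) p.18, (11) p.19, (58) p.27, (62) p.28, (82) p.30, (89) p.31, (97) p.32, (122)–(125) p.36,
(127) p.37, (159)–(163) p.42); CMP **109** (1987) 249–301 [Balaban1987RG1] ((0.4) p.253, (0.21) p.256); CMP **102** (1985) 277–309 [Balaban1985Variational] ((152) p.301).
-/

noncomputable section

open Literature.MathematicalPhysics.QuantumFieldTheory.Balaban1983to89
open T4Continuum BlockAveraging AveragingRT ExpMeanLog
open B5Eq118OneStroke (iterBlockOf iterBlockOf_succ iterBlockOf_zero)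
open B12Average012Analytic (analyticAt_units_inv)
open NormedSpace
open B15DeterminingSets (embIter)
open B7Prop1Explicit (expUnit val_expUnit)
open B10Eq27TorusAxialLog (holT holT_nil gaugeActT gaugeActT_apply axialT unitsField toUField suIncl)
open Summit.QuantumFields.YangMills.Theorems.Prop8Chart (coe_unitsField_toUField)
open Summit.QuantumFields.YangMills.Theorems.Prop8Chart (loopHolU emlAvgU coe_emlAvgU emlIterU emlIterU_zero emlIterU_succ
  norm_loopHolU_sub_one_lt_one two_block_of_mem_loopWalk exists_eq_line_of_mem_walk norm_emlIterU_sub_one_le_of_reads)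
open Summit.QuantumFields.YangMills.Theorems.Prop7SymFrameIterSmall (diff_frameAccU_le_of_reads)
open Summit.QuantumFields.YangMills.Theorems.Prop8ChartDoubleBar (norm_holT_stair_sub_one_le)
open Summit.QuantumFields.YangMills.Theorems.Prop7SymAvgRelativeBound (analyticAt_coe_holT_of_steps analyticAt_coe_emlAvgU_of_twoBlock)


/-! ## §1 — generic analyticity of the covariant double-bar tower and of the accumulated symmetric frames -/

namespace Summit.QuantumFields.YangMills.Theorems.Prop7SymFrameBound

open Summit.QuantumFields.YangMills.Theorems.Prop7SymAvgTwSym (tstairU vframeCovU coe_vframeCovU dbarCovU dbarCovU_apply dbarCovIterU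
  dbarCovIterU_zero dbarCovIterU_succ frameAccU frameAccU_zero frameAccU_succ norm_dbarCovU_mul_inv_sub_one_le norm_vframeCovU_sub_one_le_of_diff)

variable {P : Params}

section Generic

variable {j : ℕ}
variable {𝔸 : Type*} [NormedRing 𝔸] [NormedAlgebra ℂ 𝔸] [CompleteSpace 𝔸] [NormOneClass 𝔸]
variable {E : Type*} [NormedAddCommGroup E] [NormedSpace ℂ E]

omit [NormOneClass 𝔸] in
/-- **A TWISTED STAIR TRANSPORTER IS ANALYTIC IN THE PARAMETER AS SOON AS THE PERTURBED BOND VARIABLES ON ITS STAIR ARE** (the background leg is constant).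
[cite: Balaban1985Averaging, (58) p.27, (82) p.30] -/
theorem analyticAt_coe_tstairU_of_steps {F : E → GaugeField P j 𝔸ˣ} {x₀ : E} (U₀ : GaugeField P j 𝔸ˣ) (y : Site P (j + 1)) (i : Idx P)
    (hF : ∀ st ∈ walk (emb y) (stairWord i.2.1 (off i.1)), AnalyticAt ℂ (fun x => ((F x st.bond : 𝔸ˣ) : 𝔸)) x₀) :
    AnalyticAt ℂ (fun x => ((tstairU U₀ (F x) y i : 𝔸ˣ) : 𝔸)) x₀ := by
  have h : (fun x => ((tstairU U₀ (F x) y i : 𝔸ˣ) : 𝔸)) = fun x =>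
      ((holT (F x) (emb y) (stairWord i.2.1 (off i.1)) : 𝔸ˣ) : 𝔸) * (((holT U₀ (emb y) (stairWord i.2.1 (off i.1)))⁻¹ : 𝔸ˣ) : 𝔸) := by
    funext x; rw [tstairU, Units.val_mul]
  rw [h]
  exact (analyticAt_coe_holT_of_steps _ _ hF).mul analyticAt_const

omit [NormOneClass 𝔸] in
/-- **THE COVARIANT FRAME IS ANALYTIC IN THE PARAMETER** as soon as the perturbed bond variables in the block are and the twisted stair transporters at `x₀` are within `1`
of `1` (`ExpMeanLog.analyticAt_eml`). [cite: Balaban1985Averaging, (82) p.30, (62) p.28] -/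
theorem analyticAt_coe_vframeCovU (hj : j + 1 ≤ P.m + P.K) {F : E → GaugeField P j 𝔸ˣ} {x₀ : E} (U₀ : GaugeField P j 𝔸ˣ) (y : Site P (j + 1))
    (hF : ∀ b : PBond P j, blockOf b.src = y → blockOf b.tgt = y → AnalyticAt ℂ (fun x => ((F x b : 𝔸ˣ) : 𝔸)) x₀)
    (hnear : ∀ i : Idx P, ‖((tstairU U₀ (F x₀) y i : 𝔸ˣ) : 𝔸) - 1‖ < 1) :
    AnalyticAt ℂ (fun x => ((vframeCovU U₀ (F x) y : 𝔸ˣ) : 𝔸)) x₀ := by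
  have h : (fun x => ((vframeCovU U₀ (F x) y : 𝔸ˣ) : 𝔸)) = fun x => eml (fun i : Idx P => ((tstairU U₀ (F x) y i : 𝔸ˣ) : 𝔸)) := by
    funext x; exact coe_vframeCovU U₀ (F x) y
  rw [h]
  have hfam : AnalyticAt ℂ (fun x => fun i : Idx P => ((tstairU U₀ (F x) y i : 𝔸ˣ) : 𝔸)) x₀ :=
    analyticAt_pi_iff.mpr fun i => analyticAt_coe_tstairU_of_steps U₀ y i fun st hst =>
      hF st.bond (blockOf_ends_of_mem_stairWalk hj y i.1 i.2.1 st hst).1 (blockOf_ends_of_mem_stairWalk hj y i.1 i.2.1 st hst).2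
  exact AnalyticAt.comp_of_eq (analyticAt_eml hnear) hfam rfl

omit [NormedAlgebra ℂ 𝔸] [CompleteSpace 𝔸] in
/-- **THE TWISTED STAIR TRANSPORTERS ARE WITHIN `7∕8` OF `1`** when the perturbed field and the background are both within `ρ` of `1` in the block, `16ℓρ ≤ 1`
(`‖W(Γ) − 1‖ ≤ 4ℓρ ≤ ¼`, `‖U₀(Γ)⁻¹ − 1‖ ≤ 2·4ℓρ ≤ ½`). [cite: Balaban1985Averaging, (122)-(123) p.36, (82) p.30] -/
theorem norm_tstairU_sub_one_lt_one (hj : j + 1 ≤ P.m + P.K) (U₀ W : GaugeField P j 𝔸ˣ) (y : Site P (j + 1)) {ρ : ℝ} (hρ0 : 0 ≤ ρ)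
    (hρ : 16 * (((P.d + 2) * P.L : ℕ) : ℝ) * ρ ≤ 1)
    (hW : ∀ b : PBond P j, blockOf b.src = y → blockOf b.tgt = y → ‖((W b : 𝔸ˣ) : 𝔸) - 1‖ ≤ ρ)
    (hU : ∀ b : PBond P j, blockOf b.src = y → blockOf b.tgt = y → ‖((U₀ b : 𝔸ˣ) : 𝔸) - 1‖ ≤ ρ) (i : Idx P) :
    ‖((tstairU U₀ W y i : 𝔸ˣ) : 𝔸) - 1‖ < 1 := by
  set ℓ : ℝ := (((P.d + 2) * P.L : ℕ) : ℝ) with hℓ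
  have hℓ0 : 0 ≤ ℓ := Nat.cast_nonneg _
  have h4 : 4 * ℓ * ρ ≤ 1 := by nlinarith [mul_nonneg hℓ0 hρ0]
  have ha := (norm_holT_stair_sub_one_le hj y hρ0 h4 hW i).1
  have hb := (norm_holT_stair_sub_one_le hj y hρ0 h4 hU i).1
  set a : 𝔸 := ((holT W (emb y) (stairWord i.2.1 (off i.1)) : 𝔸ˣ) : 𝔸) with ha_def
  set u : 𝔸ˣ := holT U₀ (emb y) (stairWord i.2.1 (off i.1)) with hu_def
  have hq : 4 * ℓ * ρ ≤ 1 / 4 := by nlinarith [mul_nonneg hℓ0 hρ0]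
  have hb' : ‖((u⁻¹ : 𝔸ˣ) : 𝔸) - 1‖ ≤ 1 / 2 := by
    have := B7Prop6Flat.norm_units_inv_sub_one_le u (hb.trans (by linarith))
    linarith [this, hb.trans hq]
  have ha' : ‖a - 1‖ ≤ 1 / 4 := ha.trans hq
  have hval : ((tstairU U₀ W y i : 𝔸ˣ) : 𝔸) = a * ((u⁻¹ : 𝔸ˣ) : 𝔸) := by rw [tstairU, Units.val_mul]
  rw [hval]
  have hid : a * ((u⁻¹ : 𝔸ˣ) : 𝔸) - 1 = (a - 1) * (((u⁻¹ : 𝔸ˣ) : 𝔸) - 1) + (a - 1) + (((u⁻¹ : 𝔸ˣ) : 𝔸) - 1) := by noncomm_ring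
  rw [hid]
  calc ‖(a - 1) * (((u⁻¹ : 𝔸ˣ) : 𝔸) - 1) + (a - 1) + (((u⁻¹ : 𝔸ˣ) : 𝔸) - 1)‖
      ≤ ‖a - 1‖ * ‖((u⁻¹ : 𝔸ˣ) : 𝔸) - 1‖ + ‖a - 1‖ + ‖((u⁻¹ : 𝔸ˣ) : 𝔸) - 1‖ :=
        (norm_add_le _ _).trans (add_le_add ((norm_add_le _ _).trans (add_le_add (norm_mul_le _ _) le_rfl)) le_rfl)
    _ ≤ 1 / 4 * (1 / 2) + 1 / 4 + 1 / 2 := by gcongr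
    _ < 1 := by norm_num

omit [NormOneClass 𝔸] in
/-- **LOCAL ANALYTICITY OF THE COVARIANT DOUBLE-BAR ONE STEP** `x ↦ U̿[F x](c) = w(c₋)⁻¹·Ū[F x](c)·w(c₊)`: bondwise analyticity on the two blocks of `c`, loops within `1`
of `1`, twisted stairs at both ends within `1` of `1`. [cite: Balaban1985Averaging, (89) p.31; Balaban1987RG1, (0.4) p.253] -/
theorem analyticAt_coe_dbarCovU_of_twoBlock (hj : j + 1 ≤ P.m + P.K) {F : E → GaugeField P j 𝔸ˣ} {x₀ : E} (U₀ : GaugeField P j 𝔸ˣ) (c : PBond P (j + 1))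
    (hF : ∀ b : PBond P j, (blockOf b.src = c.src ∨ blockOf b.src = c.tgt) → (blockOf b.tgt = c.src ∨ blockOf b.tgt = c.tgt) →
      AnalyticAt ℂ (fun x => ((F x b : 𝔸ˣ) : 𝔸)) x₀)
    (hloop : ∀ i : Idx P, ‖((loopHolU (F x₀) c i : 𝔸ˣ) : 𝔸) - 1‖ < 1)
    (hsrc : ∀ i : Idx P, ‖((tstairU U₀ (F x₀) c.src i : 𝔸ˣ) : 𝔸) - 1‖ < 1)
    (htgt : ∀ i : Idx P, ‖((tstairU U₀ (F x₀) c.tgt i : 𝔸ˣ) : 𝔸) - 1‖ < 1) :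
    AnalyticAt ℂ (fun x => ((dbarCovU U₀ (F x) c : 𝔸ˣ) : 𝔸)) x₀ := by
  have h : (fun x => ((dbarCovU U₀ (F x) c : 𝔸ˣ) : 𝔸)) = fun x =>
      (((vframeCovU U₀ (F x) c.src)⁻¹ : 𝔸ˣ) : 𝔸) * ((emlAvgU (F x) c : 𝔸ˣ) : 𝔸) * ((vframeCovU U₀ (F x) c.tgt : 𝔸ˣ) : 𝔸) := by
    funext x; rw [dbarCovU_apply, Units.val_mul, Units.val_mul]
  rw [h]
  have hs : AnalyticAt ℂ (fun x => ((vframeCovU U₀ (F x) c.src : 𝔸ˣ) : 𝔸)) x₀ :=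
    analyticAt_coe_vframeCovU hj U₀ c.src (fun b hb1 hb2 => hF b (Or.inl hb1) (Or.inl hb2)) hsrc
  have ht : AnalyticAt ℂ (fun x => ((vframeCovU U₀ (F x) c.tgt : 𝔸ˣ) : 𝔸)) x₀ :=
    analyticAt_coe_vframeCovU hj U₀ c.tgt (fun b hb1 hb2 => hF b (Or.inr hb1) (Or.inr hb2)) htgt
  exact ((analyticAt_units_inv hs).mul (analyticAt_coe_emlAvgU_of_twoBlock hj c hF hloop)).mul ht

/-- ★★ **W4 §1 — THE COVARIANT DOUBLE-BAR TOWER AND THE ACCUMULATED SYMMETRIC FRAMES OF AN ANALYTIC FAMILY ARE ANALYTIC**, at every parameter `x₀` where the family is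
bondwise analytic, GIVEN the level rows «perturbed tower and background tower within `ρ` of `1` on the read territory» (reads in the W2 currency: background within `s₀` of `1`, perturbation within `δ` of the background) (`16ℓρ ≤ 1`; the rows are W2
`…SymFrameIterSmall` ∕ `Prop8Chart.norm_emlIterU_sub_one_le_of_reads` in the application).  Shape = ✓`Prop7SymAvgRelativeAnalytic.analyticAt_coe_emlIterU_family_of_reads`
with the frames carried along: induction on the level, `S′ = {y | blockOf y ∈ S}`, loops by `norm_loopHolU_sub_one_lt_one`, stairs by `norm_tstairU_sub_one_lt_one`.
[cite: Balaban1985Averaging, (89) p.31, (97) p.32, (127) p.37; Balaban1987RG1, (0.4) p.253, (0.21) p.256] -/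
theorem analyticAt_coe_dbarCovIterU_frameAccU_of_rows (F : E → GaugeField P 0 𝔸ˣ) (x₀ : E)
    (hF0 : ∀ b : PBond P 0, AnalyticAt ℂ (fun x => ((F x b : 𝔸ˣ) : 𝔸)) x₀) (U₀ : GaugeField P 0 𝔸ˣ)
    {k : ℕ} (hk : k ≤ P.m + P.K) {s₀ δ ρ : ℝ} (hρ0 : 0 ≤ ρ) (hρ : 16 * (((P.d + 2) * P.L : ℕ) : ℝ) * ρ ≤ 1)
    (hrow : ∀ i, i ≤ k → ∀ T : Set (Site P i),
      (∀ b : PBond P 0, iterBlockOf i b.src ∈ T → iterBlockOf i b.tgt ∈ T → ‖((U₀ b : 𝔸ˣ) : 𝔸) - 1‖ ≤ s₀ ∧ ‖((F x₀ b : 𝔸ˣ) : 𝔸) - ((U₀ b : 𝔸ˣ) : 𝔸)‖ ≤ δ) →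
      ∀ e : PBond P i, e.src ∈ T → e.tgt ∈ T →
        ‖((dbarCovIterU i U₀ (F x₀) e : 𝔸ˣ) : 𝔸) - 1‖ ≤ ρ ∧ ‖((emlIterU i U₀ e : 𝔸ˣ) : 𝔸) - 1‖ ≤ ρ) :
    ∀ i, i ≤ k → ∀ S : Set (Site P i),
      (∀ b : PBond P 0, iterBlockOf i b.src ∈ S → iterBlockOf i b.tgt ∈ S → ‖((U₀ b : 𝔸ˣ) : 𝔸) - 1‖ ≤ s₀ ∧ ‖((F x₀ b : 𝔸ˣ) : 𝔸) - ((U₀ b : 𝔸ˣ) : 𝔸)‖ ≤ δ) →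
      (∀ e : PBond P i, e.src ∈ S → e.tgt ∈ S → AnalyticAt ℂ (fun x : E => ((dbarCovIterU i U₀ (F x) e : 𝔸ˣ) : 𝔸)) x₀) ∧
      (∀ z : Site P i, z ∈ S → AnalyticAt ℂ (fun x : E => ((frameAccU i U₀ (F x) z : 𝔸ˣ) : 𝔸)) x₀) := by
  set ℓ : ℝ := (((P.d + 2) * P.L : ℕ) : ℝ) with hℓ
  have hℓ0 : (0 : ℝ) ≤ ℓ := Nat.cast_nonneg _
  have h4lt : 4 * ℓ * ρ < 1 := by nlinarith [mul_nonneg hℓ0 hρ0]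
  intro i
  induction i with
  | zero =>
    intro _ S _
    refine ⟨fun e _ _ => by simpa only [dbarCovIterU_zero] using hF0 e, fun z _ => ?_⟩
    simpa only [frameAccU_zero] using (analyticAt_const : AnalyticAt ℂ (fun _ : E => ((1 : 𝔸ˣ) : 𝔸)) x₀)
  | succ i ih =>
    intro hi S hA
    have hi' : i ≤ k := Nat.le_of_succ_le hi
    have hiK : i + 1 ≤ P.m + P.K := hi.trans hk
    set S' : Set (Site P i) := {y | blockOf y ∈ S} with hS'
    have hA' : ∀ b : PBond P 0, iterBlockOf i b.src ∈ S' → iterBlockOf i b.tgt ∈ S' →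
        ‖((U₀ b : 𝔸ˣ) : 𝔸) - 1‖ ≤ s₀ ∧ ‖((F x₀ b : 𝔸ˣ) : 𝔸) - ((U₀ b : 𝔸ˣ) : 𝔸)‖ ≤ δ :=
      fun b hs ht => hA b (by rw [iterBlockOf_succ]; exact hs) (by rw [iterBlockOf_succ]; exact ht)
    obtain ⟨ihW, ihΦ⟩ := ih hi' S' hA'
    have hnear := hrow i hi' S' hA'
    -- the level-`i` objects: perturbed tower `W x`, background tower `Uᵢ`
    set W : E → GaugeField P i 𝔸ˣ := fun x => dbarCovIterU i U₀ (F x) with hW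
    have hmem2 : ∀ (c : PBond P (i + 1)), c.src ∈ S → c.tgt ∈ S → ∀ b : PBond P i,
        (blockOf b.src = c.src ∨ blockOf b.src = c.tgt) → (blockOf b.tgt = c.src ∨ blockOf b.tgt = c.tgt) → b.src ∈ S' ∧ b.tgt ∈ S' := by
      intro c hcs hct b hbs hbt
      constructor
      · show blockOf b.src ∈ S
        rcases hbs with h | h <;> rw [h]
        exacts [hcs, hct]
      · show blockOf b.tgt ∈ S
        rcases hbt with h | h <;> rw [h]
        exacts [hcs, hct]
    have hmem1 : ∀ (y : Site P (i + 1)), y ∈ S → ∀ b : PBond P i, blockOf b.src = y → blockOf b.tgt = y → b.src ∈ S' ∧ b.tgt ∈ S' := by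
      intro y hy b hbs hbt
      exact ⟨show blockOf b.src ∈ S by rw [hbs]; exact hy, show blockOf b.tgt ∈ S by rw [hbt]; exact hy⟩
    -- twisted stairs within `1` of `1` at every site of `S`
    have hstair : ∀ y : Site P (i + 1), y ∈ S → ∀ ι : Idx P, ‖((tstairU (emlIterU i U₀) (W x₀) y ι : 𝔸ˣ) : 𝔸) - 1‖ < 1 := by
      intro y hy ι
      refine norm_tstairU_sub_one_lt_one hiK (emlIterU i U₀) (W x₀) y hρ0 hρ (fun b hbs hbt => ?_) (fun b hbs hbt => ?_) ι
      · exact (hnear b (hmem1 y hy b hbs hbt).1 (hmem1 y hy b hbs hbt).2).1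
      · exact (hnear b (hmem1 y hy b hbs hbt).1 (hmem1 y hy b hbs hbt).2).2
    -- frames analytic at every site of `S`
    have hframe : ∀ y : Site P (i + 1), y ∈ S → AnalyticAt ℂ (fun x => ((vframeCovU (emlIterU i U₀) (W x) y : 𝔸ˣ) : 𝔸)) x₀ := by
      intro y hy
      exact analyticAt_coe_vframeCovU hiK (emlIterU i U₀) y
        (fun b hbs hbt => ihW b (hmem1 y hy b hbs hbt).1 (hmem1 y hy b hbs hbt).2) (hstair y hy)
    refine ⟨fun c hcs hct => ?_, fun z hz => ?_⟩
    · -- the bond variable one level up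
      have hfun : (fun x : E => ((dbarCovIterU (i + 1) U₀ (F x) c : 𝔸ˣ) : 𝔸)) = fun x => ((dbarCovU (emlIterU i U₀) (W x) c : 𝔸ˣ) : 𝔸) := by
        funext x; rw [dbarCovIterU_succ]
      rw [hfun]
      refine analyticAt_coe_dbarCovU_of_twoBlock hiK (emlIterU i U₀) c
        (fun b hbs hbt => ihW b (hmem2 c hcs hct b hbs hbt).1 (hmem2 c hcs hct b hbs hbt).2) ?_ (hstair c.src hcs) (hstair c.tgt hct)
      exact norm_loopHolU_sub_one_lt_one hiK c hρ0 h4lt fun b hbs hbt =>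
        (hnear b (hmem2 c hcs hct b hbs hbt).1 (hmem2 c hcs hct b hbs hbt).2).1
    · -- the accumulated frame one level up
      have hfun : (fun x : E => ((frameAccU (i + 1) U₀ (F x) z : 𝔸ˣ) : 𝔸)) =
          fun x => ((frameAccU i U₀ (F x) (emb z) : 𝔸ˣ) : 𝔸) * ((vframeCovU (emlIterU i U₀) (W x) z : 𝔸ˣ) : 𝔸) := by
        funext x; rw [frameAccU_succ, Units.val_mul]
      rw [hfun]
      have hemb : emb z ∈ S' := by show blockOf (emb z) ∈ S; rw [Site.blockOf_emb hiK]; exact hz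
      exact (ihΦ (emb z) hemb).mul (hframe z hz)

/-! ## §2 — the same, with the nearness rows DISCHARGED by W2 `diff_frameAccU_le_of_reads` and the background tower's own smallness -/

/-- ★★ **ANALYTICITY OF THE COVARIANT DOUBLE-BAR TOWER AND OF THE ACCUMULATED FRAMES FROM FINE READS** — §1 with `ρ := 2Lᵏ(δ + 30ℓs₀) + 30ℓLᵏs₀`: the perturbed
tower is within `Lⁱ(δ+30ℓs₀)(1 + Dℓ²·) ≤ 2Lᵏ(δ+30ℓs₀)` of the background tower (W2 ✓`Prop7SymFrameIterSmall.diff_frameAccU_le_of_reads`, its one-step rows `hstep`∕`hframe`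
displayed VERBATIM — suppliers `Prop7SymAvgTwSym.norm_dbarCovU_mul_inv_sub_one_le`∕`norm_vframeCovU_sub_one_le_of_diff` of W1), which is within `30ℓLⁱs₀` of `1`
(✓`Prop8Chart.norm_emlIterU_sub_one_le_of_reads`); budgets at the top level `k` (monotone in the level).
[cite: Balaban1985Averaging, (159)-(163) p.42, (97) p.32, (127) p.37; Balaban1987RG1, (0.4) p.253, (0.21) p.256] -/
theorem analyticAt_coe_dbarCovIterU_frameAccU_of_reads {C₁ : ℝ} (hC₁ : 2 ≤ C₁)
    (hstep : ∀ (j : ℕ), j + 1 ≤ P.m + P.K → ∀ (U₀ W : GaugeField P j 𝔸ˣ) (c : PBond P (j + 1)) (s₀ s₁ δ : ℝ), 0 ≤ s₀ → 0 ≤ s₁ → 0 ≤ δ →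
      120 * (((P.d + 2) * P.L : ℕ) : ℝ) * (s₀ + s₁) ≤ 1 →
      (∀ b : PBond P j, (blockOf b.src = c.src ∨ blockOf b.src = c.tgt) → (blockOf b.tgt = c.src ∨ blockOf b.tgt = c.tgt) →
        ‖((U₀ b : 𝔸ˣ) : 𝔸) - 1‖ ≤ s₀ ∧ ‖((W b : 𝔸ˣ) : 𝔸) - 1‖ ≤ s₁ ∧ ‖((W b : 𝔸ˣ) : 𝔸) - ((U₀ b : 𝔸ˣ) : 𝔸)‖ ≤ δ) →
      ‖((dbarCovU U₀ W c : 𝔸ˣ) : 𝔸) * (((emlAvgU U₀ c)⁻¹ : 𝔸ˣ) : 𝔸) - 1‖ ≤ (P.L : ℝ) * δ + C₁ * (((P.d + 2) * P.L : ℕ) : ℝ) ^ 2 * (s₀ + s₁) ^ 2)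
    (hframe : ∀ (j : ℕ), j + 1 ≤ P.m + P.K → ∀ (U₀ W : GaugeField P j 𝔸ˣ) (y : Site P (j + 1)) (s₀ s₁ δ : ℝ), 0 ≤ s₀ → 0 ≤ s₁ → 0 ≤ δ →
      120 * (((P.d + 2) * P.L : ℕ) : ℝ) * (s₀ + s₁) ≤ 1 →
      (∀ b : PBond P j, blockOf b.src = y → blockOf b.tgt = y →
        ‖((U₀ b : 𝔸ˣ) : 𝔸) - 1‖ ≤ s₀ ∧ ‖((W b : 𝔸ˣ) : 𝔸) - 1‖ ≤ s₁ ∧ ‖((W b : 𝔸ˣ) : 𝔸) - ((U₀ b : 𝔸ˣ) : 𝔸)‖ ≤ δ) →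
      ‖((vframeCovU U₀ W y : 𝔸ˣ) : 𝔸) - 1‖ ≤ (((P.d + 2) * P.L : ℕ) : ℝ) * δ + C₁ * (((P.d + 2) * P.L : ℕ) : ℝ) ^ 2 * (s₀ + s₁) ^ 2)
    (F : E → GaugeField P 0 𝔸ˣ) (x₀ : E) (hF0 : ∀ b : PBond P 0, AnalyticAt ℂ (fun x => ((F x b : 𝔸ˣ) : 𝔸)) x₀) (U₀ : GaugeField P 0 𝔸ˣ)
    {k : ℕ} (hk : k ≤ P.m + P.K) {s₀ δ : ℝ} (hs₀ : 0 ≤ s₀) (hδ : 0 ≤ δ)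
    (hbud₀ : 6400 * (((P.d + 2) * P.L : ℕ) : ℝ) ^ 2 * (P.L : ℝ) ^ k * s₀ ≤ 1)
    (hbud : 8 * (16 * C₁ + 2) * (((P.d + 2) * P.L : ℕ) : ℝ) ^ 2 * ((P.L : ℝ) ^ k * (δ + 30 * (((P.d + 2) * P.L : ℕ) : ℝ) * s₀)) ≤ 1)
    (hρ : 16 * (((P.d + 2) * P.L : ℕ) : ℝ) *
      (2 * ((P.L : ℝ) ^ k * (δ + 30 * (((P.d + 2) * P.L : ℕ) : ℝ) * s₀)) + 30 * (((P.d + 2) * P.L : ℕ) : ℝ) * (P.L : ℝ) ^ k * s₀) ≤ 1) :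
    ∀ i, i ≤ k → ∀ S : Set (Site P i),
      (∀ b : PBond P 0, iterBlockOf i b.src ∈ S → iterBlockOf i b.tgt ∈ S →
        ‖((U₀ b : 𝔸ˣ) : 𝔸) - 1‖ ≤ s₀ ∧ ‖((F x₀ b : 𝔸ˣ) : 𝔸) - ((U₀ b : 𝔸ˣ) : 𝔸)‖ ≤ δ) →
      (∀ e : PBond P i, e.src ∈ S → e.tgt ∈ S → AnalyticAt ℂ (fun x : E => ((dbarCovIterU i U₀ (F x) e : 𝔸ˣ) : 𝔸)) x₀) ∧
      (∀ z : Site P i, z ∈ S → AnalyticAt ℂ (fun x : E => ((frameAccU i U₀ (F x) z : 𝔸ˣ) : 𝔸)) x₀) := by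
  set ℓ : ℝ := (((P.d + 2) * P.L : ℕ) : ℝ) with hℓ
  have hℓ0 : (0 : ℝ) ≤ ℓ := Nat.cast_nonneg _
  have hL1 : (1 : ℝ) ≤ P.L := by exact_mod_cast P.L_pos
  set g : ℝ := δ + 30 * ℓ * s₀ with hg
  have hg0 : 0 ≤ g := by positivity
  set ρ : ℝ := 2 * ((P.L : ℝ) ^ k * g) + 30 * ℓ * (P.L : ℝ) ^ k * s₀ with hρdef
  have hρ0 : 0 ≤ ρ := by positivity
  refine analyticAt_coe_dbarCovIterU_frameAccU_of_rows F x₀ hF0 U₀ hk (s₀ := s₀) (δ := δ) hρ0 hρ fun i hi T hT e hs ht => ?_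
  have hiK : i ≤ P.m + P.K := hi.trans hk
  have hLi : (P.L : ℝ) ^ i ≤ (P.L : ℝ) ^ k := pow_le_pow_right₀ hL1 hi
  have hLi0 : (0 : ℝ) ≤ (P.L : ℝ) ^ i := by positivity
  have hbud₀i : 6400 * ℓ ^ 2 * (P.L : ℝ) ^ i * s₀ ≤ 1 := by
    have : 6400 * ℓ ^ 2 * (P.L : ℝ) ^ i * s₀ ≤ 6400 * ℓ ^ 2 * (P.L : ℝ) ^ k * s₀ := by
      have h0 : 0 ≤ 6400 * ℓ ^ 2 * s₀ := by positivity
      nlinarith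
    exact this.trans hbud₀
  have hC₁0 : 0 ≤ 16 * C₁ + 2 := by linarith
  have hxi : (P.L : ℝ) ^ i * g ≤ (P.L : ℝ) ^ k * g := mul_le_mul_of_nonneg_right hLi hg0
  have hbudi : 8 * (16 * C₁ + 2) * ℓ ^ 2 * ((P.L : ℝ) ^ i * g) ≤ 1 := by
    have : 8 * (16 * C₁ + 2) * ℓ ^ 2 * ((P.L : ℝ) ^ i * g) ≤ 8 * (16 * C₁ + 2) * ℓ ^ 2 * ((P.L : ℝ) ^ k * g) := by
      have h0 : 0 ≤ 8 * (16 * C₁ + 2) * ℓ ^ 2 := by positivity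
      nlinarith
    exact this.trans hbud
  -- W2: the perturbed tower is close to the background tower
  have hW := (diff_frameAccU_le_of_reads hC₁ hstep hframe i hiK T U₀ (F x₀) s₀ δ hs₀ hδ hbud₀i hbudi hT).1 e hs ht
  -- the background tower is close to `1`
  have hU : ‖((emlIterU i U₀ e : 𝔸ˣ) : 𝔸) - 1‖ ≤ 30 * ℓ * (P.L : ℝ) ^ i * s₀ :=
    norm_emlIterU_sub_one_le_of_reads hiK T U₀ hs₀ hbud₀i (fun b hb₁ hb₂ => (hT b hb₁ hb₂).1) e hs ht
  have hU' : 30 * ℓ * (P.L : ℝ) ^ i * s₀ ≤ 30 * ℓ * (P.L : ℝ) ^ k * s₀ := by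
    have h0 : 0 ≤ 30 * ℓ * s₀ := by positivity
    nlinarith
  have hxx : (P.L : ℝ) ^ i * g * (1 + (16 * C₁ + 2) * ℓ ^ 2 * ((P.L : ℝ) ^ i * g)) ≤ 2 * ((P.L : ℝ) ^ k * g) := by
    have h1 : (16 * C₁ + 2) * ℓ ^ 2 * ((P.L : ℝ) ^ i * g) ≤ 1 := by nlinarith [mul_nonneg (mul_nonneg hC₁0 (sq_nonneg ℓ)) (mul_nonneg hLi0 hg0)]
    have h2 : 0 ≤ (P.L : ℝ) ^ i * g := mul_nonneg hLi0 hg0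
    nlinarith
  have hbg : 30 * ℓ * (P.L : ℝ) ^ k * s₀ ≤ ρ := by
    rw [hρdef]; nlinarith [mul_nonneg (pow_nonneg (le_trans zero_le_one hL1) k) hg0]
  refine ⟨?_, hU.trans (hU'.trans hbg)⟩
  calc ‖((dbarCovIterU i U₀ (F x₀) e : 𝔸ˣ) : 𝔸) - 1‖
      = ‖(((dbarCovIterU i U₀ (F x₀) e : 𝔸ˣ) : 𝔸) - ((emlIterU i U₀ e : 𝔸ˣ) : 𝔸)) + (((emlIterU i U₀ e : 𝔸ˣ) : 𝔸) - 1)‖ := by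
        rw [sub_add_sub_cancel]
    _ ≤ ‖((dbarCovIterU i U₀ (F x₀) e : 𝔸ˣ) : 𝔸) - ((emlIterU i U₀ e : 𝔸ˣ) : 𝔸)‖ + ‖((emlIterU i U₀ e : 𝔸ˣ) : 𝔸) - 1‖ := norm_add_le _ _
    _ ≤ 2 * ((P.L : ℝ) ^ k * g) + 30 * ℓ * (P.L : ℝ) ^ k * s₀ := add_le_add (hW.trans hxx) (hU.trans hU')


omit [NormOneClass 𝔸] in
/-- **BONDWISE ANALYTICITY OF THE GAUGED PERTURBED FAMILY IN THE `GL` EXPONENT**: `A ↦ (e^{A}·V)^{û}(b) = û(b₋)·e^{A(b)}·V(b)·û(b₊)⁻¹` is analytic everywhere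
(`exp` of a continuous linear functional, constants). [cite: Balaban1985Averaging, (8) p.18; Balaban1985Variational, (152) p.301] -/
theorem analyticAt_coe_gaugeActT_expUnit_mul (û : GaugeTransf P 0 𝔸ˣ) (V : GaugeField P 0 𝔸ˣ) (b : PBond P 0) (A₀ : PBond P 0 → 𝔸) :
    AnalyticAt ℂ (fun A : PBond P 0 → 𝔸 => ((gaugeActT û (fun b => expUnit (A b) * V b) b : 𝔸ˣ) : 𝔸)) A₀ := by
  have h : (fun A : PBond P 0 → 𝔸 => ((gaugeActT û (fun b => expUnit (A b) * V b) b : 𝔸ˣ) : 𝔸)) =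
      fun A => ((û b.src : 𝔸ˣ) : 𝔸) * exp (A b) * (((V b : 𝔸ˣ) : 𝔸) * (((û b.tgt)⁻¹ : 𝔸ˣ) : 𝔸)) := by
    funext A; rw [gaugeActT_apply]; simp only [Units.val_mul, val_expUnit]; noncomm_ring
  rw [h]
  have hproj : AnalyticAt ℂ (fun A : PBond P 0 → 𝔸 => A b) A₀ :=
    (ContinuousLinearMap.proj (R := ℂ) (φ := fun _ : PBond P 0 => 𝔸) b).analyticAt A₀
  exact (analyticAt_const.mul (AnalyticAt.comp_of_eq (exp_analytic _) hproj rfl)).mul analyticAt_const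

end Generic

/-! ## §3 — W1's one-step rows in W2's shape (`C₁ := 22100`) -/

section Rows

variable {𝔸 : Type*} [NormedRing 𝔸] [NormedAlgebra ℂ 𝔸] [CompleteSpace 𝔸] [NormOneClass 𝔸]

/-- W1's relative double-bar one step (✓`Prop7SymAvgTwSym.norm_dbarCovU_mul_inv_sub_one_le`, tube constant `L`, `C₁ˢ = 22100`) in W2's conjunction shape.
[cite: Balaban1985Averaging, (89) p.31, (122)-(125) p.36] -/
theorem hstep_of_W1 : ∀ (j : ℕ), j + 1 ≤ P.m + P.K → ∀ (U₀ W : GaugeField P j 𝔸ˣ) (c : PBond P (j + 1)) (s₀ s₁ δ : ℝ), 0 ≤ s₀ → 0 ≤ s₁ → 0 ≤ δ →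
      120 * (((P.d + 2) * P.L : ℕ) : ℝ) * (s₀ + s₁) ≤ 1 →
      (∀ b : PBond P j, (blockOf b.src = c.src ∨ blockOf b.src = c.tgt) → (blockOf b.tgt = c.src ∨ blockOf b.tgt = c.tgt) →
        ‖((U₀ b : 𝔸ˣ) : 𝔸) - 1‖ ≤ s₀ ∧ ‖((W b : 𝔸ˣ) : 𝔸) - 1‖ ≤ s₁ ∧ ‖((W b : 𝔸ˣ) : 𝔸) - ((U₀ b : 𝔸ˣ) : 𝔸)‖ ≤ δ) →
      ‖((dbarCovU U₀ W c : 𝔸ˣ) : 𝔸) * (((emlAvgU U₀ c)⁻¹ : 𝔸ˣ) : 𝔸) - 1‖ ≤ (P.L : ℝ) * δ + 22100 * (((P.d + 2) * P.L : ℕ) : ℝ) ^ 2 * (s₀ + s₁) ^ 2 :=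
  fun _ hj _ _ c _ _ _ hs₀ hs₁ hδ hℓ hb =>
    norm_dbarCovU_mul_inv_sub_one_le hj c hs₀ hs₁ hδ hℓ (fun b h₁ h₂ => (hb b h₁ h₂).1) (fun b h₁ h₂ => (hb b h₁ h₂).2.1) (fun b h₁ h₂ => (hb b h₁ h₂).2.2)

/-- W1's covariant frame row (✓`Prop7SymAvgTwSym.norm_vframeCovU_sub_one_le_of_diff`, `3000 ≤ 22100`) in W2's conjunction shape. [cite: Balaban1985Averaging, (82) p.30, (62) p.28] -/
theorem hframe_of_W1 : ∀ (j : ℕ), j + 1 ≤ P.m + P.K → ∀ (U₀ W : GaugeField P j 𝔸ˣ) (y : Site P (j + 1)) (s₀ s₁ δ : ℝ), 0 ≤ s₀ → 0 ≤ s₁ → 0 ≤ δ →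
      120 * (((P.d + 2) * P.L : ℕ) : ℝ) * (s₀ + s₁) ≤ 1 →
      (∀ b : PBond P j, blockOf b.src = y → blockOf b.tgt = y →
        ‖((U₀ b : 𝔸ˣ) : 𝔸) - 1‖ ≤ s₀ ∧ ‖((W b : 𝔸ˣ) : 𝔸) - 1‖ ≤ s₁ ∧ ‖((W b : 𝔸ˣ) : 𝔸) - ((U₀ b : 𝔸ˣ) : 𝔸)‖ ≤ δ) →
      ‖((vframeCovU U₀ W y : 𝔸ˣ) : 𝔸) - 1‖ ≤ (((P.d + 2) * P.L : ℕ) : ℝ) * δ + 22100 * (((P.d + 2) * P.L : ℕ) : ℝ) ^ 2 * (s₀ + s₁) ^ 2 := by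
  intro j hj U₀ W y s₀ s₁ δ hs₀ hs₁ hδ hℓ hb
  have h := norm_vframeCovU_sub_one_le_of_diff hj y hs₀ hs₁ hδ hℓ (fun b h₁ h₂ => (hb b h₁ h₂).1) (fun b h₁ h₂ => (hb b h₁ h₂).2.1)
    (fun b h₁ h₂ => (hb b h₁ h₂).2.2)
  refine h.trans ?_
  have h0 : 0 ≤ (((P.d + 2) * P.L : ℕ) : ℝ) ^ 2 * (s₀ + s₁) ^ 2 := by positivity
  nlinarith

end Rows

end Summit.QuantumFields.YangMills.Theorems.Prop7SymFrameBound

end
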